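import Literature.NumberTheory.CubicFields.ShintaniFunctionalEquation
import Literature.NumberTheory.CubicFields.ShintaniLandauKernel
import Literature.NumberTheory.CubicFields.LandauPartialSummation
import Literature.NumberTheory.CubicFields.ShintaniDualDensityBounds
import Literature.NumberTheory.CubicFields.ShintaniZetaConvergence
import Literature.NumberTheory.LFunctions.RieszPerronOrderThree
import Literature.Analysis.Complex.CahenMellinDirichlet
import Literature.Analysis.Complex.RademacherPhragmenLindelof
import Mathlib.NumberTheory.LSeries.Linearity
import Mathlib.MeasureTheory.Group.Integral
import Mathlib.MeasureTheory.Measure.Haar.Unique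
import HarnessLib

/-!
# Landau's contour identity for the diagonal Shintani zeta functions `θ^ε(s, Φ_m)` (BTT §3 / [LDTT] §2.2, `k = 3`)

Topic `Literature/NumberTheory/CubicFields`. Bhargava–Taniguchi–Thorne 2023, proof of Theorem 3.1 (p. 11): "For each
positive integer `k`, a variant of Perron's formula states that
`Γ(k+1)⁻¹ Σ_{n<X} a(Φ_m, n)(X − n)^k = (1/2πi) ∫_{2−i∞}^{2+i∞} ξ(s, Φ_m) X^{s+k}/(s(s+1)⋯(s+k)) ds`. Shifting (eqn:perron)
to a line to the left of the critical strip, the two main terms in (eqn:landau) come from the poles of `ξ(s)`. As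
`ξ(s)` grows polynomially on this line as `|Im(s)| → ∞`, for `k` sufficiently large the integral in (eqn:perron) will
converge absolutely. We then use the functional equation, expand the dual zeta function `ξ(s, Φ̂_m)` as an absolutely
convergent Dirichlet series, and switch the order of summation and integration. Then (eqn:perron) becomes
`Σ_{σ ∈ {1, 5/6}} X^{k+σ}/(σ(σ+1)⋯(σ+k)) · Res_{s=σ} ξ(s, Φ_m) + (X^k/k!)·ξ(0, Φ_m) + m^{4k+4} Σ_{n≥1} a(Φ̂_m, n) n^{−k−1} I_k(nX/m⁴)`."

This file PROVES that identity for `k = 3` and the diagonal components `θ^ε = √3 ξ⁺ + ε ξ⁻` of (eq:FE), from the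
schema `HasShintaniFE Φ` (`ShintaniFunctionalEquation.lean`) and `btt_uniformity_sqDvd` (Prop. 4.5 at `q = 1`, for the
absolute convergence of the primal and dual Dirichlet series):

* `rieszTheta_eq` — for `X > 0`:
  `Σ_{n ≤ X} f^ε_n (X − n)³ = ρ₁^ε X⁴/4 + ρ_{5/6}^ε K(5/6) X^{23/6} + θ^ε(0) X³ + 3ε Σ_{n ≥ 1} β^ε_n T^ε(n/m⁴, X)`,
  where `f^ε_n = √3 a⁺(Φ,n) + ε a⁻(Φ,n)`, `ρ_σ^ε = √3 Res_σ ξ⁺ + ε Res_σ ξ⁻`, `K(s) = 6/(s(s+1)(s+2)(s+3))`,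
  `β^ε_n = √3 a⁺(Φ̂,n) + ε a⁻(Φ̂,n)` and `T^ε` is the kernel of `ShintaniLandauKernel.lean` on the line `Re w = 13/12`
  (the Perron formula of order three of the tree, `RieszPerron3.sum_mul_sub_cube_eq_integral_LSeries`; the residue
  theorem for the strip `−1/12 ≤ Re s ≤ 2`, `Literature.Analysis.Complex.integral_vertical_sub_eq_sum_of_simplePoles`,
  the growth in the strip by Rademacher's Phragmén–Lindelöf theorem from the finite-order clause of the schema; (eq:FE)
  on `Re s = 13/12`; `∫ Σ = Σ ∫` by absolute convergence);
* the ingredients, all proved here: the polynomial growth `|θ^ε(z)| ≪ ‖1+z‖^{13/3}` on `−1/12 ≤ Re z ≤ 2`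
  (`exists_norm_thetaNum_le_strip`), integrability of the Perron integrand on both lines and its decay on horizontal
  segments, the three simple poles `1, 5/6, 0` with residues `X⁴ρ₁/4, X^{23/6}ρ_{5/6}K(5/6), X³θ_cont(0)`
  (`integral_perronF_two_sub_left`), and the termwise evaluation of the left integral (`integral_perronF_left`);
  the bound `θ^ε_cont(0) ≪ δ̂₁(Φ_m)` ("a straightforward argument", BTT p. 11) is proved in the sequel
  `UniformLandauShintani.lean`;
* the majorant `dualMajorant Φ n = a⁺(|Φ̂|,n) + a⁻(|Φ̂|,n)` of `|β^ε_n|/2`, with partial sums `≤ δ̂₁(Φ_m) m⁻⁴ N`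
  (`sum_range_dualMajorant_le`, from `ShintaniDualDensityBounds.lean`).

Everything here is PROVED; the definitions are abbreviations for the displayed objects (no named facts).

## References

* M. Bhargava, T. Taniguchi, F. Thorne, *Improved error estimates for the Davenport–Heilbronn theorems*,
  Math. Ann. 389 (2024) = arXiv:2107.12819, §3, proof of Thm 3.1 ((eqn:perron) and the display after it).
  [BhargavaTaniguchiThorne2023]
* D. Lowry-Duda, T. Taniguchi, F. Thorne, *Uniform bounds for lattice point counting and partial sums of zeta
  functions*, Math. Z. 300 (2022) = arXiv:1710.02190, §2.2 ((eq:A_base), (eq:post_shift), (eq:def_Srho), (eq:def_Wp)).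
  [LowrydudaTaniguchiThorne2017]
-/

noncomputable section

open Complex Real Set Filter MeasureTheory Topology
open Literature.NumberTheory.CubicFields.ShintaniGamma

namespace Literature.NumberTheory.CubicFields

namespace LandauContour

variable {m : ℕ}

/-! ### The objects -/

/-- The Perron kernel of order three, `K(s) = 6/(s(s+1)(s+2)(s+3)) = Γ(s)Γ(4)/Γ(s+4)`.
[cite: BhargavaTaniguchiThorne2023, §3 (eqn:perron) (X^{s+k}/(s(s+1)⋯(s+k)), k = 3)] -/
def perronK (s : ℂ) : ℂ := 6 / (s * (s + 1) * (s + 2) * (s + 3))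

/-- The diagonal primal coefficients `f^ε_n = √3 a⁺(Φ_m, n) + ε a⁻(Φ_m, n)`. [cite: BhargavaTaniguchiThorne2023, §3 (ξ(s, Φ_m) = Σ a(Φ_m, n) n^{-s} for √3 ξ⁺ ± ξ⁻)] -/
def thetaCoeff (ε : ℤ) (Φ : BinaryCubic (ZMod m) → ℂ) (n : ℕ) : ℂ :=
  (Real.sqrt 3 : ℂ) * shintaniCoeffMod Φ 1 n + (ε : ℂ) * shintaniCoeffMod Φ (-1) n

/-- The diagonal dual coefficients `β^ε_n = √3 a⁺(Φ̂_m, n) + ε a⁻(Φ̂_m, n)`. [cite: BhargavaTaniguchiThorne2023, §3 (ξ(s, Φ̂_m) := Σ a(Φ̂_m, n) = √3 ξ⁺(s, Φ̂_m) ± ξ⁻(s, Φ̂_m))] -/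
def dualThetaCoeff (ε : ℤ) (Φ : BinaryCubic (ZMod m) → ℂ) (n : ℕ) : ℂ :=
  (Real.sqrt 3 : ℂ) * shintaniDualCoeff Φ 1 n + (ε : ℂ) * shintaniDualCoeff Φ (-1) n

/-- The nonnegative majorant `x_n = a⁺(|Φ̂_m|, n) + a⁻(|Φ̂_m|, n)` (`x_0 = 0`), whose partial sums are `≤ δ̂₁ m⁻⁴ N`.
[cite: BhargavaTaniguchiThorne2023, Thm 3.1 (18) (the coefficients of δ̂₁(Φ_m))] -/
def dualMajorant (Φ : BinaryCubic (ZMod m) → ℂ) (n : ℕ) : ℝ :=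
  if n = 0 then 0 else (dualAbsCoeff Φ 1 n).re + (dualAbsCoeff Φ (-1) n).re

/-- `A³_θ(X) = Σ_{0 < n ≤ X} f^ε_n (X − n)³`, the order-three Riesz sum of `θ^ε`. [cite: BhargavaTaniguchiThorne2023, §3 (eqn:perron) (left side, k = 3, times Γ(4))] -/
def rieszTheta (ε : ℤ) (Φ : BinaryCubic (ZMod m) → ℂ) (X : ℝ) : ℂ :=
  ∑ n ∈ Finset.Ioc 0 ⌊X⌋₊, thetaCoeff ε Φ n * ((X : ℂ) - n) ^ 3

/-- The Perron integrand `F(s) = X^{3+s} θ^ε_cont(s) K(s)`. [cite: BhargavaTaniguchiThorne2023, §3 (eqn:perron) (integrand)] -/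
def perronF (ε : ℤ) (Φ : BinaryCubic (ZMod m) → ℂ) (X : ℝ) (s : ℂ) : ℂ :=
  (X : ℂ) ^ (3 + s) * thetaCont ε Φ s * perronK s

/-! ### The majorant of the dual coefficients -/

/-- `x_n ≥ 0`. [folklore] -/
theorem dualMajorant_nonneg (Φ : BinaryCubic (ZMod m) → ℂ) (n : ℕ) : 0 ≤ dualMajorant Φ n := by
  unfold dualMajorant; split_ifs
  · exact le_rfl
  · exact add_nonneg (dualAbsCoeff_re_nonneg Φ 1 n).1 (dualAbsCoeff_re_nonneg Φ (-1) n).1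

/-- A function on the finite set `V(ℤ/mℤ)` (`m ≥ 1`) is bounded. [folklore] -/
theorem exists_bound [NeZero m] (Φ : BinaryCubic (ZMod m) → ℂ) : ∃ B : ℝ, 0 ≤ B ∧ ∀ y, ‖Φ y‖ ≤ B :=
  ⟨∑ y, ‖Φ y‖, Finset.sum_nonneg fun _ _ => norm_nonneg _,
    fun y => Finset.single_le_sum (fun _ _ => norm_nonneg _) (Finset.mem_univ y)⟩

/-- **`Σ_{n<N} x_n ≤ δ̂₁(Φ_m) m⁻⁴ N`** (the supremum defining `δ̂₁`, Thm 3.1 (18), under Prop. 4.5 at `q = 1` so that the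
supremum is finite). [cite: BhargavaTaniguchiThorne2023, Thm 3.1 (18) (δ̂₁ = m⁴ sup_N N⁻¹ Σ_α Σ_{n<N} a^α(|Φ̂_m|, n))] -/
theorem sum_range_dualMajorant_le [NeZero m] (hU : btt_uniformity_sqDvd) (Φ : BinaryCubic (ZMod m) → ℂ) (N : ℕ) :
    ∑ n ∈ Finset.range N, dualMajorant Φ n ≤ dualDensity Φ / (m : ℝ) ^ 4 * N := by
  obtain ⟨B, hB, hΦ⟩ := exists_bound Φ
  have hm : (0 : ℝ) < (m : ℝ) ^ 4 := by have := NeZero.ne m; positivity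
  rcases Nat.eq_zero_or_pos N with rfl | hN
  · simp
  have h := mul_dualPartialDensity_le_dualDensity hU hB hΦ N
  rw [dualPartialDensity] at h
  have hsum : ∑ n ∈ Finset.range N, dualMajorant Φ n =
      ∑ n ∈ Finset.Ico 1 N, ((dualAbsCoeff Φ 1 n).re + (dualAbsCoeff Φ (-1) n).re) := by
    rw [Finset.range_eq_Ico, Finset.sum_eq_sum_Ico_succ_bot hN]
    simp only [dualMajorant, ↓reduceIte, zero_add]
    exact Finset.sum_congr rfl fun n hn => by rw [if_neg (by have := (Finset.mem_Ico.mp hn).1; omega)]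
  rw [hsum]
  have hNpos : (0 : ℝ) < N := by exact_mod_cast hN
  rw [div_mul_eq_mul_div, le_div_iff₀ hm]
  calc (∑ n ∈ Finset.Ico 1 N, ((dualAbsCoeff Φ 1 n).re + (dualAbsCoeff Φ (-1) n).re)) * (m : ℝ) ^ 4
      = ((m : ℝ) ^ 4 * ((N : ℝ)⁻¹ * ∑ n ∈ Finset.Ico 1 N, ((dualAbsCoeff Φ 1 n).re + (dualAbsCoeff Φ (-1) n).re))) * N := by
        field_simp
    _ ≤ dualDensity Φ * N := mul_le_mul_of_nonneg_right h hNpos.le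

/-- `|a^{sgn}(Φ̂_m, n)| ≤ x_n` for `n ≥ 1`, `sgn = ±1`. [folklore] -/
theorem norm_shintaniDualCoeff_le_dualMajorant (Φ : BinaryCubic (ZMod m) → ℂ) {sgn : ℤ} (hs : sgn = 1 ∨ sgn = -1)
    {n : ℕ} (hn : n ≠ 0) : ‖shintaniDualCoeff Φ sgn n‖ ≤ dualMajorant Φ n := by
  rw [dualMajorant, if_neg hn]
  rcases hs with rfl | rfl
  · exact (norm_shintaniDualCoeff_le Φ (Or.inl rfl) hn).trans (le_add_of_nonneg_right (dualAbsCoeff_re_nonneg Φ _ n).1)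
  · exact (norm_shintaniDualCoeff_le Φ (Or.inr rfl) hn).trans (le_add_of_nonneg_left (dualAbsCoeff_re_nonneg Φ _ n).1)

/-- **`|β^ε_n| ≤ 2 x_n`** for `n ≥ 1` (`√3 ≤ 2`). [folklore] -/
theorem norm_dualThetaCoeff_le (Φ : BinaryCubic (ZMod m) → ℂ) {ε : ℤ} (hε : ε = 1 ∨ ε = -1) {n : ℕ} (hn : n ≠ 0) :
    ‖dualThetaCoeff ε Φ n‖ ≤ 2 * dualMajorant Φ n := by
  have h1 := norm_shintaniDualCoeff_le Φ (Or.inl rfl) hn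
  have h2 := norm_shintaniDualCoeff_le Φ (Or.inr rfl) hn
  have hx1 := (dualAbsCoeff_re_nonneg Φ 1 n).1
  have hx2 := (dualAbsCoeff_re_nonneg Φ (-1) n).1
  have hsqrt : ‖(Real.sqrt 3 : ℂ)‖ ≤ 2 := by
    rw [Complex.norm_real, Real.norm_eq_abs, abs_of_nonneg (Real.sqrt_nonneg _)]
    rw [show (2 : ℝ) = Real.sqrt 4 by rw [show (4 : ℝ) = 2 ^ 2 by norm_num, Real.sqrt_sq zero_le_two]]
    exact Real.sqrt_le_sqrt (by norm_num)
  have hεn : ‖(ε : ℂ)‖ = 1 := by rcases hε with rfl | rfl <;> simp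
  rw [dualMajorant, if_neg hn]
  calc ‖dualThetaCoeff ε Φ n‖ ≤ ‖(Real.sqrt 3 : ℂ)‖ * ‖shintaniDualCoeff Φ 1 n‖ + ‖(ε : ℂ)‖ * ‖shintaniDualCoeff Φ (-1) n‖ := by
        unfold dualThetaCoeff
        exact (norm_add_le _ _).trans (by rw [norm_mul, norm_mul])
    _ ≤ 2 * (dualAbsCoeff Φ 1 n).re + 1 * (dualAbsCoeff Φ (-1) n).re := by rw [hεn]; gcongr
    _ ≤ 2 * ((dualAbsCoeff Φ 1 n).re + (dualAbsCoeff Φ (-1) n).re) := by linarith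

/-- **The dual Dirichlet series converge absolutely for `Re s > 1`** (under Prop. 4.5): `LSeriesSummable a^{sgn}(Φ̂_m, ·)`.
[cite: BhargavaTaniguchiThorne2023, Thm 2.4 (absolute convergence for Re(s) > 1), applied to Φ̂_m] -/
theorem lseriesSummable_shintaniDualCoeff [NeZero m] (hU : btt_uniformity_sqDvd) (Φ : BinaryCubic (ZMod m) → ℂ)
    {sgn : ℤ} (hs : sgn = 1 ∨ sgn = -1) {s : ℂ} (hσ : 1 < s.re) : LSeriesSummable (shintaniDualCoeff Φ sgn) s := by
  have hsum := LandauSums.summable_mul_rpow_neg (dualMajorant_nonneg Φ) (sum_range_dualMajorant_le hU Φ) hσ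
  refine Summable.of_norm_bounded hsum fun n => ?_
  rw [LSeries.norm_term_eq]
  split_ifs with hn
  · exact mul_nonneg (dualMajorant_nonneg Φ n) (by positivity)
  · rw [div_eq_mul_inv, ← Real.rpow_neg (Nat.cast_nonneg n)]
    exact mul_le_mul_of_nonneg_right (norm_shintaniDualCoeff_le_dualMajorant Φ hs hn) (by positivity)

/-- `θ^ε(s, Φ̂_m) = L(β^ε, s)` for `Re s > 1`. [folklore] -/
theorem dualTheta_eq_LSeries [NeZero m] (hU : btt_uniformity_sqDvd) (ε : ℤ) (Φ : BinaryCubic (ZMod m) → ℂ) {s : ℂ}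
    (hσ : 1 < s.re) : dualTheta ε Φ s = LSeries (dualThetaCoeff ε Φ) s := by
  have h1 := lseriesSummable_shintaniDualCoeff hU Φ (Or.inl rfl) hσ
  have h2 := lseriesSummable_shintaniDualCoeff hU Φ (Or.inr rfl) hσ
  have e : dualThetaCoeff ε Φ = ((Real.sqrt 3 : ℂ) • shintaniDualCoeff Φ 1) + ((ε : ℂ) • shintaniDualCoeff Φ (-1)) := by
    funext n; simp [dualThetaCoeff]
  rw [e, LSeries_add (h1.smul _) (h2.smul _), LSeries_smul, LSeries_smul, dualTheta]

/-- **`Σ_n |β^ε_n| n^{−σ} < ∞` and the explicit bounds from the majorant**, for `σ > 1`. [folklore] -/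
theorem summable_norm_dualThetaCoeff_mul [NeZero m] (hU : btt_uniformity_sqDvd) {ε : ℤ} (hε : ε = 1 ∨ ε = -1)
    (Φ : BinaryCubic (ZMod m) → ℂ) {σ : ℝ} (hσ : 1 < σ) :
    Summable fun n : ℕ => ‖dualThetaCoeff ε Φ n‖ * (n : ℝ) ^ (-σ) := by
  have hsum := (LandauSums.summable_mul_rpow_neg (dualMajorant_nonneg Φ) (sum_range_dualMajorant_le hU Φ) hσ).mul_left 2
  refine Summable.of_nonneg_of_le (fun n => by positivity) (fun n => ?_) hsum
  rcases Nat.eq_zero_or_pos n with rfl | hn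
  · simp [Real.zero_rpow (by linarith : -σ ≠ 0)]
  · calc ‖dualThetaCoeff ε Φ n‖ * (n : ℝ) ^ (-σ) ≤ 2 * dualMajorant Φ n * (n : ℝ) ^ (-σ) :=
          mul_le_mul_of_nonneg_right (norm_dualThetaCoeff_le Φ hε (by omega)) (by positivity)
      _ = 2 * (dualMajorant Φ n * (n : ℝ) ^ (-σ)) := by ring

/-! ### The primal side: `θ^ε_cont = L(f^ε, ·)` on `Re s > 1`, Perron's formula -/

/-- `θ^ε_cont(s, Φ_m) = L(f^ε, s)` for `Re s > 1` (under the schema and Prop. 4.5). [folklore] -/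
theorem thetaCont_eq_LSeries [NeZero m] (hU : btt_uniformity_sqDvd) {Φ : BinaryCubic (ZMod m) → ℂ}
    (hFE : HasShintaniFE Φ) (ε : ℤ) {s : ℂ} (hσ : 1 < s.re) : thetaCont ε Φ s = LSeries (thetaCoeff ε Φ) s := by
  obtain ⟨B, -, hΦ⟩ := exists_bound Φ
  have h1 := lseriesSummable_shintaniCoeffMod hU (Φ := Φ) ⟨B, hΦ⟩ (Or.inl rfl) hσ
  have h2 := lseriesSummable_shintaniCoeffMod hU (Φ := Φ) ⟨B, hΦ⟩ (Or.inr rfl) hσ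
  have e : thetaCoeff ε Φ = ((Real.sqrt 3 : ℂ) • shintaniCoeffMod Φ 1) + ((ε : ℂ) • shintaniCoeffMod Φ (-1)) := by
    funext n; simp [thetaCoeff]
  rw [e, LSeries_add (h1.smul _) (h2.smul _), LSeries_smul, LSeries_smul, hFE.thetaCont_eq ε hσ, shintaniZetaMod,
    shintaniZetaMod]

/-- `L(f^ε, ·)` converges absolutely for `Re s > 1`. [folklore] -/
theorem lseriesSummable_thetaCoeff [NeZero m] (hU : btt_uniformity_sqDvd) (ε : ℤ) (Φ : BinaryCubic (ZMod m) → ℂ)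
    {s : ℂ} (hσ : 1 < s.re) : LSeriesSummable (thetaCoeff ε Φ) s := by
  obtain ⟨B, -, hΦ⟩ := exists_bound Φ
  have h1 := lseriesSummable_shintaniCoeffMod hU (Φ := Φ) ⟨B, hΦ⟩ (Or.inl rfl) hσ
  have h2 := lseriesSummable_shintaniCoeffMod hU (Φ := Φ) ⟨B, hΦ⟩ (Or.inr rfl) hσ
  have e : thetaCoeff ε Φ = ((Real.sqrt 3 : ℂ) • shintaniCoeffMod Φ 1) + ((ε : ℂ) • shintaniCoeffMod Φ (-1)) := by
    funext n; simp [thetaCoeff]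
  rw [e]; exact (h1.smul _).add (h2.smul _)

/-- **Perron's formula of order three for `θ^ε`**: `A³_θ(X) = (1/2π) ∫ F(2 + it) dt` (`X > 0`).
[cite: BhargavaTaniguchiThorne2023, §3 (eqn:perron) (k = 3, line Re s = 2)] -/
theorem rieszTheta_eq_integral [NeZero m] (hU : btt_uniformity_sqDvd) {Φ : BinaryCubic (ZMod m) → ℂ}
    (hFE : HasShintaniFE Φ) (ε : ℤ) {X : ℝ} (hX : 0 < X) :
    rieszTheta ε Φ X = (1 / (2 * π) : ℂ) * ∫ t : ℝ, perronF ε Φ X (2 + t * I) := by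
  have h := Literature.NumberTheory.LFunctions.RieszPerron3.sum_mul_sub_cube_eq_integral_LSeries (thetaCoeff ε Φ) hX
    (σ := 2) two_pos (lseriesSummable_thetaCoeff hU ε Φ (by simp))
  rw [rieszTheta, h]
  congr 1
  refine integral_congr_ae (ae_of_all _ fun t => ?_)
  have hre : 1 < ((2 : ℂ) + t * I).re := by simp
  simp only [perronF, perronK, thetaCont_eq_LSeries hU hFE ε hre]
  push_cast
  ring


/-! ### Uniform bounds for absolutely convergent Dirichlet series -/

/-- `‖L(f, s)‖ ≤ Σ_n ‖f(n)‖ n^{−σ}` for `Re s ≥ σ`, when `L(f, σ)` converges. [folklore] -/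
theorem norm_LSeries_le_of_le_re {f : ℕ → ℂ} {σ : ℝ} (hf : LSeriesSummable f σ) {s : ℂ} (hs : σ ≤ s.re) :
    ‖LSeries f s‖ ≤ ∑' n, ‖LSeries.term f σ n‖ := by
  have hσ : Summable fun n => ‖LSeries.term f σ n‖ := summable_norm_iff.mpr hf
  have hle : ∀ n, ‖LSeries.term f s n‖ ≤ ‖LSeries.term f σ n‖ :=
    LSeries.norm_term_le_of_re_le_re f (by simpa using hs)
  have hs' : Summable fun n => ‖LSeries.term f s n‖ := hσ.of_nonneg_of_le (fun _ => norm_nonneg _) hle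
  exact (norm_tsum_le_tsum_norm hs').trans (Summable.tsum_le_tsum hle hs' hσ)

/-- **`‖θ^ε_cont(s)‖ ≤ M_θ` for `Re s ≥ 2`** (`θ_cont = L(f^ε, ·)` there). [folklore] -/
theorem exists_norm_thetaCont_le_of_two_le [NeZero m] (hU : btt_uniformity_sqDvd) {Φ : BinaryCubic (ZMod m) → ℂ}
    (hFE : HasShintaniFE Φ) (ε : ℤ) : ∃ M : ℝ, 0 ≤ M ∧ ∀ s : ℂ, 2 ≤ s.re → ‖thetaCont ε Φ s‖ ≤ M := by
  refine ⟨∑' n, ‖LSeries.term (thetaCoeff ε Φ) (2 : ℝ) n‖, tsum_nonneg fun _ => norm_nonneg _, fun s hs => ?_⟩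
  rw [thetaCont_eq_LSeries hU hFE ε (by linarith)]
  exact norm_LSeries_le_of_le_re (lseriesSummable_thetaCoeff hU ε Φ (by norm_num)) hs

/-- `L(β^ε, ·)` converges absolutely for `Re s > 1`. [folklore] -/
theorem lseriesSummable_dualThetaCoeff [NeZero m] (hU : btt_uniformity_sqDvd) (ε : ℤ) (Φ : BinaryCubic (ZMod m) → ℂ)
    {s : ℂ} (hσ : 1 < s.re) : LSeriesSummable (dualThetaCoeff ε Φ) s := by
  have h1 := lseriesSummable_shintaniDualCoeff hU Φ (Or.inl rfl) hσ
  have h2 := lseriesSummable_shintaniDualCoeff hU Φ (Or.inr rfl) hσ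
  have e : dualThetaCoeff ε Φ = ((Real.sqrt 3 : ℂ) • shintaniDualCoeff Φ 1) + ((ε : ℂ) • shintaniDualCoeff Φ (-1)) := by
    funext n; simp [dualThetaCoeff]
  rw [e]; exact (h1.smul _).add (h2.smul _)

/-- **`‖θ^ε(s, Φ̂_m)‖ ≤ M_σ` for `Re s ≥ σ > 1`.** [folklore] -/
theorem exists_norm_dualTheta_le [NeZero m] (hU : btt_uniformity_sqDvd) (ε : ℤ) (Φ : BinaryCubic (ZMod m) → ℂ)
    {σ : ℝ} (hσ : 1 < σ) : ∃ M : ℝ, 0 ≤ M ∧ ∀ s : ℂ, σ ≤ s.re → ‖dualTheta ε Φ s‖ ≤ M := by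
  refine ⟨∑' n, ‖LSeries.term (dualThetaCoeff ε Φ) σ n‖, tsum_nonneg fun _ => norm_nonneg _, fun s hs => ?_⟩
  rw [dualTheta_eq_LSeries hU ε Φ (by linarith)]
  exact norm_LSeries_le_of_le_re (lseriesSummable_dualThetaCoeff hU ε Φ (by simpa using hσ)) hs

/-! ### The Perron kernel `K(s) = 6/(s(s+1)(s+2)(s+3))` -/

/-- `‖K(s)‖ ≤ 6/|Im s|⁴`. [folklore] -/
theorem norm_perronK_le_of_im {s : ℂ} (hs : s.im ≠ 0) : ‖perronK s‖ ≤ 6 / |s.im| ^ 4 := by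
  have hT : 0 < |s.im| := abs_pos.mpr hs
  have h0 : |s.im| ≤ ‖s‖ := Complex.abs_im_le_norm s
  have h : ∀ j : ℕ, |s.im| ≤ ‖s + j‖ := fun j => by
    have := Complex.abs_im_le_norm (s + j); simpa using this
  have h1 := h 1; have h2 := h 2; have h3 := h 3
  push_cast at h1 h2 h3
  have hprod : |s.im| ^ 4 ≤ ‖s * (s + 1) * (s + 2) * (s + 3)‖ := by
    rw [norm_mul, norm_mul, norm_mul]
    calc |s.im| ^ 4 = |s.im| * |s.im| * |s.im| * |s.im| := by ring
      _ ≤ ‖s‖ * ‖s + 1‖ * ‖s + 2‖ * ‖s + 3‖ :=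
          mul_le_mul (mul_le_mul (mul_le_mul h0 h1 hT.le (norm_nonneg _)) h2 hT.le (by positivity)) h3 hT.le
            (by positivity)
  have hpos : 0 < ‖s * (s + 1) * (s + 2) * (s + 3)‖ := lt_of_lt_of_le (by positivity) hprod
  rw [perronK, norm_div, show ‖(6 : ℂ)‖ = 6 by simp, div_le_div_iff₀ hpos (by positivity)]
  nlinarith

/-- `‖K(2 + it)‖ ≤ 96/(1 + |t|)⁴`. [folklore] -/
theorem norm_perronK_two_line (t : ℝ) : ‖perronK (2 + t * I)‖ ≤ 96 / (1 + |t|) ^ 4 := by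
  have h := Literature.NumberTheory.LFunctions.RieszPerron3.norm_kernel_le (s := 2 + t * I) (δ := 1) one_pos le_rfl
    (by norm_num) (by norm_num) (by norm_num) (by norm_num)
  simpa [perronK] using h

/-- `‖K(−1/12 + it)‖ ≤ 96 · 12⁴/(1 + |t|)⁴`. [folklore] -/
theorem norm_perronK_left_line (t : ℝ) : ‖perronK (((-1 / 12 : ℝ) : ℂ) + t * I)‖ ≤ 96 * 12 ^ 4 / (1 + |t|) ^ 4 := by
  have h := Literature.NumberTheory.LFunctions.RieszPerron3.norm_kernel_le (s := ((-1 / 12 : ℝ) : ℂ) + t * I)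
    (δ := 1 / 12) (by norm_num) (by norm_num) (by norm_num) (by norm_num) (by norm_num) (by norm_num)
  have e : (96 : ℝ) * 12 ^ 4 / (1 + |t|) ^ 4 = 96 / ((1 / 12) ^ 4 * (1 + |t|) ^ 4) := by
    field_simp
  rw [e]; simpa [perronK] using h

/-- `K` is holomorphic off `{0, −1, −2, −3}`. [folklore] -/
theorem differentiableAt_perronK {z : ℂ} (h0 : z ≠ 0) (h1 : z + 1 ≠ 0) (h2 : z + 2 ≠ 0) (h3 : z + 3 ≠ 0) :
    DifferentiableAt ℂ perronK z := by
  unfold perronK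
  exact (differentiableAt_const _).div (by fun_prop) (mul_ne_zero (mul_ne_zero (mul_ne_zero h0 h1) h2) h3)

/-! ### Elementary geometry of the strip `−1/12 ≤ Re z ≤ 2` -/

/-- `‖1 + z‖ ≥ 11/12` for `Re z ≥ −1/12`. [folklore] -/
theorem norm_one_add_ge {z : ℂ} (hz : -1 / 12 ≤ z.re) : 11 / 12 ≤ ‖1 + z‖ := by
  have h := Complex.abs_re_le_norm (1 + z)
  rw [add_re, one_re, abs_of_nonneg (by linarith)] at h
  linarith

/-- `‖z − c‖ ≤ 4‖1 + z‖` for `Re z ≥ −1/12`, `0 ≤ c ≤ 1`. [folklore] -/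
theorem norm_sub_le_four_mul {z : ℂ} (hz : -1 / 12 ≤ z.re) {c : ℝ} (hc0 : 0 ≤ c) (hc1 : c ≤ 1) :
    ‖z - c‖ ≤ 4 * ‖1 + z‖ := by
  have h1 := norm_one_add_ge hz
  have hc : ‖(1 : ℂ) + c‖ ≤ 2 := by
    rw [show (1 : ℂ) + c = ((1 + c : ℝ) : ℂ) by push_cast; ring, Complex.norm_real, Real.norm_eq_abs,
      abs_of_nonneg (by linarith)]
    linarith
  calc ‖z - c‖ = ‖(1 + z) - (1 + c)‖ := by congr 1; ring
    _ ≤ ‖1 + z‖ + ‖(1 : ℂ) + c‖ := norm_sub_le _ _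
    _ ≤ 4 * ‖1 + z‖ := by linarith

/-- `1 + |Im z| ≤ 3‖1 + z‖` for `Re z ≥ −1/12`. [folklore] -/
theorem one_add_abs_im_le {z : ℂ} (hz : -1 / 12 ≤ z.re) : 1 + |z.im| ≤ 3 * ‖1 + z‖ := by
  have h1 := norm_one_add_ge hz
  have h2 : |z.im| ≤ ‖1 + z‖ := by have := Complex.abs_im_le_norm (1 + z); simpa using this
  linarith

/-- `θ^ε = θ^ε_cont · (s − 1)(s − 5/6)` off the poles. [folklore] -/
theorem thetaNum_eq_mul (ε : ℤ) (Φ : BinaryCubic (ZMod m) → ℂ) {z : ℂ} (h1 : z ≠ 1) (h56 : z ≠ 5 / 6) :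
    thetaNum ε Φ z = thetaCont ε Φ z * ((z - 1) * (z - 5 / 6)) := by
  rw [thetaCont, div_mul_cancel₀]
  exact mul_ne_zero (sub_ne_zero.mpr h1) (sub_ne_zero.mpr h56)

/-- `‖X^{3+z}‖ ≤ max (X^{35/12}) (X⁵)` on the strip. [folklore] -/
theorem norm_cpow_three_add_le {X : ℝ} (hX : 0 < X) {z : ℂ} (h1 : -1 / 12 ≤ z.re) (h2 : z.re ≤ 2) :
    ‖(X : ℂ) ^ (3 + z)‖ ≤ max (X ^ (35 / 12 : ℝ)) (X ^ (5 : ℝ)) := by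
  rw [norm_cpow_eq_rpow_re_of_pos hX]
  have hre : (3 + z).re = 3 + z.re := by simp
  rw [hre]
  rcases le_total 1 X with h | h
  · exact (Real.rpow_le_rpow_of_exponent_le h (by linarith)).trans (le_max_right _ _)
  · exact (Real.rpow_le_rpow_of_exponent_ge hX h (by linarith)).trans (le_max_left _ _)

/-! ### The left line `Re z = −1/12`: the functional equation -/

/-- **On `Re z = −1/12`: `‖θ^ε_cont(z)‖ ≤ C (1 + |Im z|)^{7/3}`** (by (eq:FE) at `s = 1 − z`, `Re s = 13/12`:
`|3ε m^{4s}| = 3m^{13/3}`, `‖Δ(s)/Δ(1−s)‖ ≪ (1+|t|)^{4·13/12−2}`, `‖θ(s, Φ̂)‖ ≤ M_{13/12}`).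
[cite: BhargavaTaniguchiThorne2023, §3 proof of Thm 3.1 ("ξ(s) grows polynomially on this line as |Im(s)| → ∞")] -/
theorem exists_norm_thetaCont_left_le [NeZero m] (hU : btt_uniformity_sqDvd) {Φ : BinaryCubic (ZMod m) → ℂ}
    (hFE : HasShintaniFE Φ) {ε : ℤ} (hε : ε = 1 ∨ ε = -1) :
    ∃ C : ℝ, 0 < C ∧ ∀ t : ℝ, ‖thetaCont ε Φ (((-1 / 12 : ℝ) : ℂ) + t * I)‖ ≤ C * (1 + |t|) ^ ((7 : ℝ) / 3) := by
  obtain ⟨CΔ, hCΔ, hΔ⟩ := exists_norm_delta_div_le (σ₁ := 13 / 12) (σ₂ := 13 / 12) (by norm_num)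
  obtain ⟨M, hM0, hM⟩ := exists_norm_dualTheta_le hU ε Φ (σ := 13 / 12) (by norm_num)
  have hm : (0 : ℝ) < m := by exact_mod_cast NeZero.pos m
  refine ⟨3 * (m : ℝ) ^ ((13 : ℝ) / 3) * CΔ * M + 1, by positivity, fun t => ?_⟩
  set s : ℂ := ((13 / 12 : ℝ) : ℂ) + (-t : ℝ) * I with hs_def
  have hz : ((-1 / 12 : ℝ) : ℂ) + t * I = 1 - s := by
    simp only [hs_def]; push_cast; ring
  have hsre : s.re = 13 / 12 := by simp [hs_def]
  have hsim : s.im = -t := by simp [hs_def]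
  rw [hz, hFE.fe ε hε s (by rw [hsre]; norm_num) (by rw [hsre]; norm_num)]
  have hΔs := hΔ ε hε (13 / 12) ⟨le_rfl, le_rfl⟩ (-t)
  rw [abs_neg, show (4 : ℝ) * (13 / 12) - 2 = 7 / 3 by norm_num] at hΔs
  have hm4 : ‖(m : ℂ) ^ (4 * s)‖ = (m : ℝ) ^ ((13 : ℝ) / 3) := by
    rw [norm_natCast_cpow_of_pos (NeZero.pos m)]
    congr 1
    rw [mul_re, hsre, hsim]; norm_num
  have hεn : ‖(ε : ℂ)‖ = 1 := by rcases hε with rfl | rfl <;> simp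
  have hMs : ‖dualTheta ε Φ s‖ ≤ M := hM s (by rw [hsre])
  have hr : 1 ≤ (1 + |t|) ^ ((7 : ℝ) / 3) := Real.one_le_rpow (by linarith [abs_nonneg t]) (by norm_num)
  have hs' : ((13 / 12 : ℝ) : ℂ) + ((-t : ℝ) : ℂ) * I = s := rfl
  rw [hs'] at hΔs
  calc ‖3 * (ε : ℂ) * (m : ℂ) ^ (4 * s) * (delta ε s / delta ε (1 - s)) * dualTheta ε Φ s‖
      = 3 * ‖(m : ℂ) ^ (4 * s)‖ * ‖delta ε s / delta ε (1 - s)‖ * ‖dualTheta ε Φ s‖ := by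
        simp only [norm_mul, hεn, mul_one]
        norm_num
    _ ≤ 3 * (m : ℝ) ^ ((13 : ℝ) / 3) * (CΔ * (1 + |t|) ^ ((7 : ℝ) / 3)) * M := by
        rw [hm4]; gcongr
    _ = (3 * (m : ℝ) ^ ((13 : ℝ) / 3) * CΔ * M) * (1 + |t|) ^ ((7 : ℝ) / 3) := by ring
    _ ≤ (3 * (m : ℝ) ^ ((13 : ℝ) / 3) * CΔ * M + 1) * (1 + |t|) ^ ((7 : ℝ) / 3) := by
        gcongr; linarith

/-! ### Polynomial growth of `θ^ε` in the strip (Phragmén–Lindelöf) -/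

/-- **`|θ^ε(z)| ≤ C ‖1 + z‖^{13/3}` for `−1/12 ≤ Re z ≤ 2`** (`θ^ε = (z−1)(z−5/6)θ^ε_cont` is entire of finite
order by the schema; on `Re z = −1/12` it is `≪ ‖1+z‖^{2+7/3}` by the functional equation, on `Re z = 2` it is
`≪ ‖1+z‖²`; Rademacher's Phragmén–Lindelöf theorem interpolates).
[cite: BhargavaTaniguchiThorne2023, §3 proof of Thm 3.1 ("As ξ(s) grows polynomially on this line … the integral in (eqn:perron) will converge absolutely")] -/
theorem exists_norm_thetaNum_le_strip [NeZero m] (hU : btt_uniformity_sqDvd) {Φ : BinaryCubic (ZMod m) → ℂ}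
    (hFE : HasShintaniFE Φ) {ε : ℤ} (hε : ε = 1 ∨ ε = -1) :
    ∃ C : ℝ, 0 < C ∧ ∀ z : ℂ, -1 / 12 ≤ z.re → z.re ≤ 2 → ‖thetaNum ε Φ z‖ ≤ C * ‖1 + z‖ ^ ((13 : ℝ) / 3) := by
  obtain ⟨CL, hCL, hL⟩ := exists_norm_thetaCont_left_le hU hFE hε
  obtain ⟨MR, hMR0, hR⟩ := exists_norm_thetaCont_le_of_two_le hU hFE ε
  obtain ⟨Cg, hCg, hgr⟩ := hFE.exists_norm_thetaNum_le hε (-1 / 12) 2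
  set A : ℝ := 16 * 3 ^ ((7 : ℝ) / 3) * CL with hA
  set B : ℝ := 16 * MR + 1 with hB
  have hA0 : 0 < A := by positivity
  have hB0 : 0 < B := by positivity
  have ha : ∀ z : ℂ, z.re = -1 / 12 → ‖thetaNum ε Φ z‖ ≤ A * ‖((1 : ℝ) : ℂ) + z‖ ^ ((13 : ℝ) / 3) := by
    intro z hz
    have hz' : -1 / 12 ≤ z.re := hz.ge
    have hr := norm_one_add_ge hz'
    have hr0 : 0 < ‖1 + z‖ := by linarith
    have e : z = ((-1 / 12 : ℝ) : ℂ) + z.im * I := by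
      apply Complex.ext <;> simp [hz]
    have h1 : z ≠ 1 := fun h => by rw [h] at hz; norm_num at hz
    have h56 : z ≠ 5 / 6 := fun h => by rw [h] at hz; norm_num at hz
    have hθ := hL z.im
    rw [← e] at hθ
    rw [thetaNum_eq_mul ε Φ h1 h56, norm_mul, norm_mul, ofReal_one]
    have hc1 : ‖z - 1‖ ≤ 4 * ‖1 + z‖ := by
      have := norm_sub_le_four_mul hz' (c := 1) zero_le_one le_rfl; simpa using this
    have hc2 : ‖z - 5 / 6‖ ≤ 4 * ‖1 + z‖ := by
      have := norm_sub_le_four_mul hz' (c := 5 / 6) (by norm_num) (by norm_num); push_cast at this; exact this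
    calc ‖thetaCont ε Φ z‖ * (‖z - 1‖ * ‖z - 5 / 6‖)
        ≤ CL * (1 + |z.im|) ^ ((7 : ℝ) / 3) * ((4 * ‖1 + z‖) * (4 * ‖1 + z‖)) := by gcongr
      _ ≤ CL * (3 * ‖1 + z‖) ^ ((7 : ℝ) / 3) * ((4 * ‖1 + z‖) * (4 * ‖1 + z‖)) := by
          gcongr; exact one_add_abs_im_le hz'
      _ = A * ‖1 + z‖ ^ ((13 : ℝ) / 3) := by
          rw [Real.mul_rpow (by norm_num) hr0.le, show (13 : ℝ) / 3 = (7 : ℝ) / 3 + 2 by norm_num,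
            Real.rpow_add hr0, Real.rpow_two, hA]
          ring
  have hb : ∀ z : ℂ, z.re = 2 → ‖thetaNum ε Φ z‖ ≤ B * ‖((1 : ℝ) : ℂ) + z‖ ^ (2 : ℝ) := by
    intro z hz
    have hz' : -1 / 12 ≤ z.re := by rw [hz]; norm_num
    have h1 : z ≠ 1 := fun h => by rw [h] at hz; norm_num at hz
    have h56 : z ≠ 5 / 6 := fun h => by rw [h] at hz; norm_num at hz
    rw [thetaNum_eq_mul ε Φ h1 h56, norm_mul, norm_mul, ofReal_one, Real.rpow_two]
    have hθ : ‖thetaCont ε Φ z‖ ≤ MR := hR z (by rw [hz])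
    have hc1 : ‖z - 1‖ ≤ 4 * ‖1 + z‖ := by
      have := norm_sub_le_four_mul hz' (c := 1) zero_le_one le_rfl; simpa using this
    have hc2 : ‖z - 5 / 6‖ ≤ 4 * ‖1 + z‖ := by
      have := norm_sub_le_four_mul hz' (c := 5 / 6) (by norm_num) (by norm_num); push_cast at this; exact this
    calc ‖thetaCont ε Φ z‖ * (‖z - 1‖ * ‖z - 5 / 6‖) ≤ MR * ((4 * ‖1 + z‖) * (4 * ‖1 + z‖)) := by gcongr
      _ ≤ B * ‖1 + z‖ ^ 2 := by rw [hB]; nlinarith [sq_nonneg ‖1 + z‖]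
  have hgr' : ∀ z : ℂ, (-1 / 12 : ℝ) < z.re → z.re < 2 →
      ‖thetaNum ε Φ z‖ ≤ Cg * Real.exp (Cg ^ 2) * Real.exp (|z.im| ^ (2 : ℝ)) := by
    intro z hz1 hz2
    refine (hgr z hz1.le hz2.le).trans ?_
    rw [mul_assoc, ← Real.exp_add, Real.rpow_two]
    gcongr
    nlinarith [sq_nonneg (Cg - |z.im|), abs_nonneg z.im]
  refine ⟨max A B * 2 ^ ((13 : ℝ) / 3), by positivity, fun z hza hzb => ?_⟩
  have h := Literature.Analysis.Complex.rademacher_phragmenLindelof_of_finiteOrder (f := thetaNum ε Φ)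
    (a := -1 / 12) (b := 2) (Q := 1) (A := A) (B := B) (α := 13 / 3) (β := 2) (C := Cg * Real.exp (Cg ^ 2)) (c := 2)
    (by norm_num) (by norm_num) hA0 hB0 (by norm_num) (differentiable_thetaNum ε Φ).diffContOnCl (by norm_num)
    hgr' ha hb hza hzb
  simp only [ofReal_one] at h
  have hr := norm_one_add_ge hza
  have hr0 : 0 < ‖1 + z‖ := by linarith
  have h2r : 1 ≤ 2 * ‖1 + z‖ := by linarith
  set T : ℝ := max A B * (2 * ‖1 + z‖) ^ ((13 : ℝ) / 3) with hT
  have hT0 : 0 < T := by positivity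
  have hP : A * ‖1 + z‖ ^ ((13 : ℝ) / 3) ≤ T := by
    rw [hT]
    gcongr
    · exact le_max_left _ _
    · linarith
  have hQ : B * ‖1 + z‖ ^ (2 : ℝ) ≤ T := by
    calc B * ‖1 + z‖ ^ (2 : ℝ) ≤ max A B * (2 * ‖1 + z‖) ^ (2 : ℝ) := by
          gcongr
          · exact le_max_right _ _
          · linarith
      _ ≤ T := by
          rw [hT]
          exact mul_le_mul_of_nonneg_left (Real.rpow_le_rpow_of_exponent_le h2r (by norm_num)) (by positivity)
  have hl1 : 0 ≤ (2 - z.re) / (2 - (-1 / 12 : ℝ)) := div_nonneg (by linarith) (by norm_num)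
  have hl2 : 0 ≤ (z.re - (-1 / 12 : ℝ)) / (2 - (-1 / 12 : ℝ)) := div_nonneg (by linarith) (by norm_num)
  have hsum : (2 - z.re) / (2 - (-1 / 12 : ℝ)) + (z.re - (-1 / 12 : ℝ)) / (2 - (-1 / 12 : ℝ)) = 1 := by
    field_simp; ring
  calc ‖thetaNum ε Φ z‖
      ≤ (A * ‖1 + z‖ ^ ((13 : ℝ) / 3)) ^ ((2 - z.re) / (2 - (-1 / 12 : ℝ))) *
          (B * ‖1 + z‖ ^ (2 : ℝ)) ^ ((z.re - (-1 / 12 : ℝ)) / (2 - (-1 / 12 : ℝ))) := h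
    _ ≤ T ^ ((2 - z.re) / (2 - (-1 / 12 : ℝ))) * T ^ ((z.re - (-1 / 12 : ℝ)) / (2 - (-1 / 12 : ℝ))) :=
        mul_le_mul (Real.rpow_le_rpow (by positivity) hP hl1) (Real.rpow_le_rpow (by positivity) hQ hl2)
          (by positivity) (by positivity)
    _ = T := by rw [← Real.rpow_add hT0, hsum, Real.rpow_one]
    _ = max A B * 2 ^ ((13 : ℝ) / 3) * ‖1 + z‖ ^ ((13 : ℝ) / 3) := by
        rw [hT, Real.mul_rpow (by norm_num) hr0.le]; ring


/-! ### The Perron integrand `F`: holomorphy, integrability on the two lines, decay -/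

/-- `F` is holomorphic off `{1, 5/6, 0}` on `Re z > −1`. [folklore] -/
theorem differentiableAt_perronF (ε : ℤ) (Φ : BinaryCubic (ZMod m) → ℂ) {X : ℝ} (hX : 0 < X) {z : ℂ}
    (hz1 : z ≠ 1) (hz56 : z ≠ 5 / 6) (hz0 : z ≠ 0) (hre : -1 < z.re) : DifferentiableAt ℂ (perronF ε Φ X) z := by
  have hθ : DifferentiableAt ℂ (thetaCont ε Φ) z :=
    (differentiableOn_thetaCont ε Φ).differentiableAt ((isOpen_ne.inter isOpen_ne).mem_nhds ⟨hz1, hz56⟩)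
  have n1 : z + 1 ≠ 0 := fun h => by have := congrArg Complex.re h; simp at this; linarith
  have n2 : z + 2 ≠ 0 := fun h => by have := congrArg Complex.re h; simp at this; linarith
  have n3 : z + 3 ≠ 0 := fun h => by have := congrArg Complex.re h; simp at this; linarith
  have hK := differentiableAt_perronK hz0 n1 n2 n3
  have hXC : (X : ℂ) ≠ 0 := by exact_mod_cast hX.ne'
  have hc : DifferentiableAt ℂ (fun s : ℂ => (X : ℂ) ^ (3 + s)) z :=
    DifferentiableAt.const_cpow (by fun_prop) (Or.inl hXC)
  unfold perronF
  exact (hc.mul hθ).mul hK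

/-- `t ↦ F(c + it)` is continuous for `c > −1`, `c ∉ {0, 5/6, 1}`. [folklore] -/
theorem continuous_perronF_line (ε : ℤ) (Φ : BinaryCubic (ZMod m) → ℂ) {X : ℝ} (hX : 0 < X) {c : ℝ} (hc : -1 < c)
    (hc1 : c ≠ 1) (hc56 : c ≠ 5 / 6) (hc0 : c ≠ 0) : Continuous fun t : ℝ => perronF ε Φ X ((c : ℂ) + t * I) := by
  refine continuous_iff_continuousAt.mpr fun t => ?_
  have hd := differentiableAt_perronF ε Φ hX (z := (c : ℂ) + t * I)
    (fun h => by have := congrArg Complex.re h; simp at this; exact hc1 this)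
    (fun h => by have := congrArg Complex.re h; norm_num at this; exact hc56 this)
    (fun h => by have := congrArg Complex.re h; simp at this; exact hc0 this) (by simpa using hc)
  change ContinuousAt ((perronF ε Φ X) ∘ (fun t : ℝ => (c : ℂ) + t * I)) t
  exact ContinuousAt.comp (f := fun t : ℝ => (c : ℂ) + t * I) (x := t) hd.continuousAt
    (by fun_prop : Continuous fun t : ℝ => (c : ℂ) + t * I).continuousAt

/-- **`F` is integrable on `Re s = 2`** (`‖F(2+it)‖ ≤ 96 X⁵ M_θ (1+|t|)⁻⁴`). [folklore] -/
theorem integrable_perronF_two [NeZero m] (hU : btt_uniformity_sqDvd) {Φ : BinaryCubic (ZMod m) → ℂ}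
    (hFE : HasShintaniFE Φ) (ε : ℤ) {X : ℝ} (hX : 0 < X) : Integrable fun t : ℝ => perronF ε Φ X (2 + t * I) := by
  obtain ⟨M, hM0, hM⟩ := exists_norm_thetaCont_le_of_two_le hU hFE ε
  have hcont : Continuous fun t : ℝ => perronF ε Φ X (2 + t * I) := by
    have := continuous_perronF_line ε Φ hX (c := 2) (by norm_num) (by norm_num) (by norm_num) (by norm_num)
    simpa using this
  have hint : Integrable fun t : ℝ => X ^ (5 : ℝ) * M * 96 * (1 + ‖t‖) ^ (-(4 : ℝ)) := by
    refine (integrable_one_add_norm (E := ℝ) (μ := volume) ?_).const_mul _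
    simp only [Module.finrank_self, Nat.cast_one]; norm_num
  refine hint.mono' hcont.aestronglyMeasurable (ae_of_all _ fun t => ?_)
  have hc : ‖(X : ℂ) ^ (3 + (2 + t * I))‖ = X ^ (5 : ℝ) := by
    rw [norm_cpow_eq_rpow_re_of_pos hX]; congr 1; simp; norm_num
  have hK := norm_perronK_two_line t
  have hθ := hM (2 + t * I) (by simp)
  have ht : 0 < 1 + |t| := by positivity
  rw [perronF, norm_mul, norm_mul, hc, Real.norm_eq_abs, Real.rpow_neg ht.le,
    show (4 : ℝ) = (4 : ℕ) by norm_num, Real.rpow_natCast]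
  calc X ^ (5 : ℝ) * ‖thetaCont ε Φ (2 + t * I)‖ * ‖perronK (2 + t * I)‖ ≤ X ^ (5 : ℝ) * M * (96 / (1 + |t|) ^ 4) := by
        gcongr
    _ = X ^ (5 : ℝ) * M * 96 * ((1 + |t|) ^ 4)⁻¹ := by ring

/-- **`F` is integrable on `Re s = −1/12`** (`‖F(−1/12+it)‖ ≪ (1+|t|)^{7/3−4}`). [folklore] -/
theorem integrable_perronF_left [NeZero m] (hU : btt_uniformity_sqDvd) {Φ : BinaryCubic (ZMod m) → ℂ}
    (hFE : HasShintaniFE Φ) {ε : ℤ} (hε : ε = 1 ∨ ε = -1) {X : ℝ} (hX : 0 < X) :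
    Integrable fun t : ℝ => perronF ε Φ X (((-1 / 12 : ℝ) : ℂ) + t * I) := by
  obtain ⟨C, hC, hL⟩ := exists_norm_thetaCont_left_le hU hFE hε
  have hcont : Continuous fun t : ℝ => perronF ε Φ X (((-1 / 12 : ℝ) : ℂ) + t * I) :=
    continuous_perronF_line ε Φ hX (by norm_num) (by norm_num) (by norm_num) (by norm_num)
  have hint : Integrable fun t : ℝ => X ^ (35 / 12 : ℝ) * C * (96 * 12 ^ 4) * (1 + ‖t‖) ^ (-(5 / 3 : ℝ)) := by
    refine (integrable_one_add_norm (E := ℝ) (μ := volume) ?_).const_mul _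
    simp only [Module.finrank_self, Nat.cast_one]; norm_num
  refine hint.mono' hcont.aestronglyMeasurable (ae_of_all _ fun t => ?_)
  have hc : ‖(X : ℂ) ^ (3 + (((-1 / 12 : ℝ) : ℂ) + t * I))‖ = X ^ (35 / 12 : ℝ) := by
    rw [norm_cpow_eq_rpow_re_of_pos hX]; congr 1; simp; norm_num
  have hK := norm_perronK_left_line t
  have hθ := hL t
  have ht : 0 < 1 + |t| := by positivity
  rw [perronF, norm_mul, norm_mul, hc, Real.norm_eq_abs]
  calc X ^ (35 / 12 : ℝ) * ‖thetaCont ε Φ (((-1 / 12 : ℝ) : ℂ) + t * I)‖ * ‖perronK (((-1 / 12 : ℝ) : ℂ) + t * I)‖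
      ≤ X ^ (35 / 12 : ℝ) * (C * (1 + |t|) ^ ((7 : ℝ) / 3)) * (96 * 12 ^ 4 / (1 + |t|) ^ 4) := by gcongr
    _ = X ^ (35 / 12 : ℝ) * C * (96 * 12 ^ 4) * ((1 + |t|) ^ ((7 : ℝ) / 3) / (1 + |t|) ^ 4) := by ring
    _ = X ^ (35 / 12 : ℝ) * C * (96 * 12 ^ 4) * (1 + |t|) ^ (-(5 / 3 : ℝ)) := by
        congr 1
        rw [show ((1 + |t|) ^ 4 : ℝ) = (1 + |t|) ^ (4 : ℝ) by
          rw [show (4 : ℝ) = (4 : ℕ) by norm_num, Real.rpow_natCast], ← Real.rpow_sub ht]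
        norm_num

/-- **`sup_{x ∈ [−1/12, 2]} ‖F(x + iT)‖ → 0` as `|T| → ∞`** (indeed `≪ |T|⁻¹`: `θ^ε ≪ |T|^{13/3} ≤ |T|⁵`, two factors
`|T|` from `(z−1)(z−5/6)` and `|K| ≤ 6|T|⁻⁴`). [folklore] -/
theorem perronF_decay [NeZero m] (hU : btt_uniformity_sqDvd) {Φ : BinaryCubic (ZMod m) → ℂ} (hFE : HasShintaniFE Φ)
    {ε : ℤ} (hε : ε = 1 ∨ ε = -1) {X : ℝ} (hX : 0 < X) (δ : ℝ) (hδ : 0 < δ) :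
    ∃ T₀ : ℝ, ∀ T : ℝ, T₀ ≤ |T| → ∀ x ∈ Icc (-1 / 12 : ℝ) 2, ‖perronF ε Φ X (x + T * I)‖ ≤ δ := by
  obtain ⟨C, hC, hθ⟩ := exists_norm_thetaNum_le_strip hU hFE hε
  set XM : ℝ := max (X ^ (35 / 12 : ℝ)) (X ^ (5 : ℝ)) with hXM
  set C'' : ℝ := XM * (C * 4 ^ 5) * 6 with hC''
  refine ⟨max 1 (C'' / δ), fun T hT x hx => ?_⟩
  have hT1 : 1 ≤ |T| := le_of_max_le_left hT
  have hT2 : C'' / δ ≤ |T| := le_of_max_le_right hT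
  have hT0 : 0 < |T| := by linarith
  obtain ⟨hx1, hx2⟩ := hx
  set z : ℂ := (x : ℂ) + T * I with hz
  have hzre : z.re = x := by simp [hz]
  have hzim : z.im = T := by simp [hz]
  have hTne : T ≠ 0 := fun h => by rw [h, abs_zero] at hT1; linarith
  have hr1 : 1 ≤ ‖1 + z‖ := hT1.trans (by have := Complex.abs_im_le_norm (1 + z); simpa [hzim] using this)
  have hr : ‖1 + z‖ ≤ 4 * |T| := by
    calc ‖1 + z‖ ≤ |(1 + z).re| + |(1 + z).im| := Complex.norm_le_abs_re_add_abs_im _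
      _ = |1 + x| + |T| := by simp [hz]
      _ ≤ 4 * |T| := by rw [abs_of_nonneg (by linarith)]; linarith
  have hnum : ‖thetaNum ε Φ z‖ ≤ C * (4 * |T|) ^ 5 := by
    calc ‖thetaNum ε Φ z‖ ≤ C * ‖1 + z‖ ^ ((13 : ℝ) / 3) := hθ z (by rw [hzre]; exact hx1) (by rw [hzre]; exact hx2)
      _ ≤ C * ‖1 + z‖ ^ (5 : ℝ) :=
          mul_le_mul_of_nonneg_left (Real.rpow_le_rpow_of_exponent_le hr1 (by norm_num)) hC.le
      _ = C * ‖1 + z‖ ^ 5 := by rw [show (5 : ℝ) = (5 : ℕ) by norm_num, Real.rpow_natCast]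
      _ ≤ C * (4 * |T|) ^ 5 := by gcongr
  have hden1 : |T| ≤ ‖z - 1‖ := by have := Complex.abs_im_le_norm (z - 1); simpa [hzim] using this
  have hden2 : |T| ≤ ‖z - 5 / 6‖ := by
    have h56im : (z - 5 / 6).im = T := by rw [sub_im, hzim]; norm_num
    have := Complex.abs_im_le_norm (z - 5 / 6); rwa [h56im] at this
  have hθc : ‖thetaCont ε Φ z‖ ≤ C * (4 * |T|) ^ 5 / (|T| * |T|) := by
    rw [thetaCont, norm_div, norm_mul]
    exact div_le_div₀ (by positivity) hnum (by positivity) (mul_le_mul hden1 hden2 hT0.le (norm_nonneg _))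
  have hK : ‖perronK z‖ ≤ 6 / |T| ^ 4 := by
    have := norm_perronK_le_of_im (s := z) (by rw [hzim]; exact hTne); rwa [hzim] at this
  have hXz : ‖(X : ℂ) ^ (3 + z)‖ ≤ XM := norm_cpow_three_add_le hX (by rw [hzre]; exact hx1) (by rw [hzre]; exact hx2)
  calc ‖perronF ε Φ X z‖ = ‖(X : ℂ) ^ (3 + z)‖ * ‖thetaCont ε Φ z‖ * ‖perronK z‖ := by rw [perronF, norm_mul, norm_mul]
    _ ≤ XM * (C * (4 * |T|) ^ 5 / (|T| * |T|)) * (6 / |T| ^ 4) := by gcongr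
    _ = C'' / |T| := by rw [hC'']; field_simp
    _ ≤ δ := by
        rw [div_le_iff₀ hT0]
        have := (div_le_iff₀ hδ).mp hT2
        linarith

/-! ### The residues at `1`, `5/6`, `0` -/

/-- `ρ^ε_1 = √3 Res_{s=1} ξ⁺(s, Φ_m) + ε Res_{s=1} ξ⁻(s, Φ_m)`. [cite: BhargavaTaniguchiThorne2023, Thm 2.4 (residues at s = 1), diagonal combination of (eq:FE)] -/
def rhoOne (ε : ℤ) (Φ : BinaryCubic (ZMod m) → ℂ) : ℂ :=
  (Real.sqrt 3 : ℂ) * shintaniRes1 Φ 1 + (ε : ℂ) * shintaniRes1 Φ (-1)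

/-- `ρ^ε_{5/6} = √3 Res_{s=5/6} ξ⁺(s, Φ_m) + ε Res_{s=5/6} ξ⁻(s, Φ_m)`. [cite: BhargavaTaniguchiThorne2023, Thm 2.4 (residues at s = 5/6), diagonal combination of (eq:FE)] -/
def rhoFiveSixths (ε : ℤ) (Φ : BinaryCubic (ZMod m) → ℂ) : ℂ :=
  (Real.sqrt 3 : ℂ) * shintaniRes56 Φ 1 + (ε : ℂ) * shintaniRes56 Φ (-1)

/-- The residues of `F` at `1`, `5/6`, `0`: `X⁴ρ₁/4`, `X^{23/6} ρ_{5/6} K(5/6)`, `X³ θ^ε_cont(0)`.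
[cite: BhargavaTaniguchiThorne2023, §3 proof of Thm 3.1 (the display after (eqn:perron), k = 3)] -/
def perronRes (ε : ℤ) (Φ : BinaryCubic (ZMod m) → ℂ) (X : ℝ) (p : ℂ) : ℂ :=
  if p = 1 then (X : ℂ) ^ (4 : ℂ) * (rhoOne ε Φ / 4)
  else if p = 5 / 6 then (X : ℂ) ^ ((23 : ℂ) / 6) * (rhoFiveSixths ε Φ * perronK (5 / 6))
  else (X : ℂ) ^ (3 : ℂ) * thetaCont ε Φ 0

/-- **The residue theorem for `F` on `−1/12 ≤ Re s ≤ 2`**: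
`∫ F(2+iy) dy − ∫ F(−1/12+iy) dy = 2π (X⁴ρ₁/4 + X^{23/6}ρ_{5/6}K(5/6) + X³θ_cont(0))`.
[cite: BhargavaTaniguchiThorne2023, §3 proof of Thm 3.1 ("Shifting (eqn:perron) to a line to the left of the critical strip, the two main terms in (eqn:landau) come from the poles of ξ(s)")] -/
theorem integral_perronF_two_sub_left [NeZero m] (hU : btt_uniformity_sqDvd) {Φ : BinaryCubic (ZMod m) → ℂ}
    (hFE : HasShintaniFE Φ) {ε : ℤ} (hε : ε = 1 ∨ ε = -1) {X : ℝ} (hX : 0 < X) :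
    (∫ y : ℝ, perronF ε Φ X (2 + y * I)) - ∫ y : ℝ, perronF ε Φ X (((-1 / 12 : ℝ) : ℂ) + y * I) =
      2 * π * ((X : ℂ) ^ (4 : ℂ) * (rhoOne ε Φ / 4) + (X : ℂ) ^ ((23 : ℂ) / 6) * (rhoFiveSixths ε Φ * perronK (5 / 6)) +
        (X : ℂ) ^ (3 : ℂ) * thetaCont ε Φ 0) := by
  classical
  have h156 : (1 : ℂ) ≠ 5 / 6 := by norm_num
  have h560 : (5 / 6 : ℂ) ≠ 0 := by norm_num
  have hXC : (X : ℂ) ≠ 0 := by exact_mod_cast hX.ne'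
  set S : Finset ℂ := {1, 5 / 6, 0} with hSdef
  set U : Set ℂ := {u : ℂ | -1 < u.re} with hUdef
  have hUo : IsOpen U := isOpen_lt continuous_const Complex.continuous_re
  have hKU : re ⁻¹' Icc (-1 / 12 : ℝ) 2 ⊆ U := fun u hu => by
    simp only [hUdef, Set.mem_setOf_eq]; exact lt_of_lt_of_le (by norm_num) hu.1
  have hS : ∀ p ∈ S, p.re ∈ Ioo (-1 / 12 : ℝ) 2 := by
    intro p hp
    simp only [hSdef, Finset.mem_insert, Finset.mem_singleton] at hp
    rcases hp with rfl | rfl | rfl <;> norm_num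
  have hF : DifferentiableOn ℂ (perronF ε Φ X) (U \ ↑S) := by
    intro z hz
    obtain ⟨hzU, hzS⟩ := hz
    have hzS' : z ≠ 1 ∧ z ≠ 5 / 6 ∧ z ≠ 0 := by simpa [hSdef] using hzS
    exact (differentiableAt_perronF ε Φ hX hzS'.1 hzS'.2.1 hzS'.2.2 hzU).differentiableWithinAt
  -- local data near a point `u` with `|Re u − c| < 1/12`
  have hloc : ∀ {c : ℝ} {u : ℂ}, dist u c < 1 / 12 → c - 1 / 12 < u.re ∧ u.re < c + 1 / 12 := by
    intro c u hu
    have h := lt_of_le_of_lt (Complex.abs_re_le_norm (u - c)) (by rwa [dist_eq_norm] at hu)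
    rw [sub_re, ofReal_re, abs_lt] at h
    constructor <;> linarith
  have hpole : ∀ p ∈ S, ∃ φ : ℂ → ℂ, ∃ V ∈ 𝓝 p, DifferentiableOn ℂ φ V ∧ φ p = perronRes ε Φ X p ∧
      ∀ z ∈ V, z ≠ p → perronF ε Φ X z = φ z / (z - p) := by
    intro p hp
    simp only [hSdef, Finset.mem_insert, Finset.mem_singleton] at hp
    rcases hp with rfl | rfl | rfl
    · -- the pole at `1`
      refine ⟨fun z => (X : ℂ) ^ (3 + z) * (thetaNum ε Φ z / (z - 5 / 6)) * perronK z, Metric.ball 1 (1 / 12),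
        Metric.ball_mem_nhds _ (by norm_num), ?_, ?_, ?_⟩
      · intro u hu
        have hre := hloc (c := 1) (by simpa using hu)
        have n56 : u - 5 / 6 ≠ 0 := fun h => by have := congrArg Complex.re h; norm_num at this; linarith
        have n0 : u ≠ 0 := fun h => by rw [h] at hre; simp at hre; linarith
        have n1 : u + 1 ≠ 0 := fun h => by have := congrArg Complex.re h; simp at this; linarith
        have n2 : u + 2 ≠ 0 := fun h => by have := congrArg Complex.re h; simp at this; linarith
        have n3 : u + 3 ≠ 0 := fun h => by have := congrArg Complex.re h; simp at this; linarith
        refine DifferentiableAt.differentiableWithinAt ?_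
        exact ((DifferentiableAt.const_cpow (by fun_prop) (Or.inl hXC)).mul
          (((differentiable_thetaNum ε Φ) u).div (by fun_prop) n56)).mul (differentiableAt_perronK n0 n1 n2 n3)
      · show (X : ℂ) ^ (3 + 1) * (thetaNum ε Φ 1 / (1 - 5 / 6)) * perronK 1 = perronRes ε Φ X 1
        rw [thetaNum_one_div, perronRes, if_pos rfl, rhoOne, perronK]
        norm_num
        ring
      · intro z hz hz1
        rw [perronF, thetaCont_eq_div_sub_one]
        ring
    · -- the pole at `5/6`
      refine ⟨fun z => (X : ℂ) ^ (3 + z) * (thetaNum ε Φ z / (z - 1)) * perronK z, Metric.ball (5 / 6) (1 / 12),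
        Metric.ball_mem_nhds _ (by norm_num), ?_, ?_, ?_⟩
      · intro u hu
        have hre := hloc (c := 5 / 6) (by push_cast; simpa using hu)
        have n1' : u - 1 ≠ 0 := fun h => by have := congrArg Complex.re h; simp at this; linarith
        have n0 : u ≠ 0 := fun h => by rw [h] at hre; simp at hre; linarith
        have n1 : u + 1 ≠ 0 := fun h => by have := congrArg Complex.re h; simp at this; linarith
        have n2 : u + 2 ≠ 0 := fun h => by have := congrArg Complex.re h; simp at this; linarith
        have n3 : u + 3 ≠ 0 := fun h => by have := congrArg Complex.re h; simp at this; linarith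
        refine DifferentiableAt.differentiableWithinAt ?_
        exact ((DifferentiableAt.const_cpow (by fun_prop) (Or.inl hXC)).mul
          (((differentiable_thetaNum ε Φ) u).div (by fun_prop) n1')).mul (differentiableAt_perronK n0 n1 n2 n3)
      · show (X : ℂ) ^ (3 + 5 / 6) * (thetaNum ε Φ (5 / 6) / (5 / 6 - 1)) * perronK (5 / 6) = perronRes ε Φ X (5 / 6)
        rw [thetaNum_div_five_sixths, perronRes, if_neg h156.symm, if_pos rfl, rhoFiveSixths]
        norm_num
        ring
      · intro z hz hz1
        rw [perronF, thetaCont_eq_div_sub]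
        ring
    · -- the pole at `0` (of the kernel)
      refine ⟨fun z => (X : ℂ) ^ (3 + z) * thetaCont ε Φ z * (6 / ((z + 1) * (z + 2) * (z + 3))), Metric.ball 0 (1 / 12),
        Metric.ball_mem_nhds _ (by norm_num), ?_, ?_, ?_⟩
      · intro u hu
        have hre := hloc (c := 0) (by simpa using hu)
        have hu1 : u ≠ 1 := fun h => by rw [h] at hre; simp at hre; linarith
        have hu56 : u ≠ 5 / 6 := fun h => by rw [h] at hre; norm_num at hre
        have n1 : u + 1 ≠ 0 := fun h => by have := congrArg Complex.re h; simp at this; linarith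
        have n2 : u + 2 ≠ 0 := fun h => by have := congrArg Complex.re h; simp at this; linarith
        have n3 : u + 3 ≠ 0 := fun h => by have := congrArg Complex.re h; simp at this; linarith
        have hθ : DifferentiableAt ℂ (thetaCont ε Φ) u :=
          (differentiableOn_thetaCont ε Φ).differentiableAt ((isOpen_ne.inter isOpen_ne).mem_nhds ⟨hu1, hu56⟩)
        refine DifferentiableAt.differentiableWithinAt ?_
        exact ((DifferentiableAt.const_cpow (by fun_prop) (Or.inl hXC)).mul hθ).mul
          ((differentiableAt_const _).div (by fun_prop) (mul_ne_zero (mul_ne_zero n1 n2) n3))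
      · show (X : ℂ) ^ (3 + 0) * thetaCont ε Φ 0 * (6 / ((0 + 1) * (0 + 2) * (0 + 3))) = perronRes ε Φ X 0
        rw [perronRes, if_neg zero_ne_one, if_neg h560.symm]
        norm_num
      · intro z hz hz0
        have hre := hloc (c := 0) (by simpa using hz)
        have n1 : z + 1 ≠ 0 := fun h => by have := congrArg Complex.re h; simp at this; linarith
        have n2 : z + 2 ≠ 0 := fun h => by have := congrArg Complex.re h; simp at this; linarith
        have n3 : z + 3 ≠ 0 := fun h => by have := congrArg Complex.re h; simp at this; linarith
        rw [sub_zero, perronF, perronK]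
        field_simp
  have hres := Literature.Analysis.Complex.integral_vertical_sub_eq_sum_of_simplePoles (F := perronF ε Φ X)
    (a := -1 / 12) (b := 2) (by norm_num) S (perronRes ε Φ X) U hUo hKU hS hF hpole
    (integrable_perronF_left hU hFE hε hX) (by simpa using integrable_perronF_two hU hFE ε hX)
    (fun δ hδ => perronF_decay hU hFE hε hX δ hδ)
  have hsum : ∑ p ∈ S, perronRes ε Φ X p = (X : ℂ) ^ (4 : ℂ) * (rhoOne ε Φ / 4) +
      (X : ℂ) ^ ((23 : ℂ) / 6) * (rhoFiveSixths ε Φ * perronK (5 / 6)) + (X : ℂ) ^ (3 : ℂ) * thetaCont ε Φ 0 := by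
    rw [hSdef, Finset.sum_insert (by norm_num), Finset.sum_insert (by norm_num), Finset.sum_singleton]
    rw [perronRes, if_pos rfl, perronRes, if_neg h156.symm, if_pos rfl, perronRes, if_neg zero_ne_one, if_neg h560.symm]
    ring
  rw [hsum] at hres
  simpa using hres

/-! ### The left line: functional equation, termwise integration -/

/-- `(n/m⁴)^{−s} = m^{4s} n^{−s}` (`n, m ≥ 1`). [folklore] -/
theorem natDiv_cpow_neg {n k : ℕ} (hn : 0 < n) (hk : 0 < k) (s : ℂ) :
    (((n : ℝ) / (k : ℝ) ^ 4 : ℝ) : ℂ) ^ (-s) = (k : ℂ) ^ (4 * s) * (n : ℂ) ^ (-s) := by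
  have hn' : (0 : ℝ) < n := by exact_mod_cast hn
  have hk' : (0 : ℝ) < k := by exact_mod_cast hk
  have hq : (0 : ℝ) < n / (k : ℝ) ^ 4 := by positivity
  rw [cpow_def_of_ne_zero (by exact_mod_cast hq.ne'), ← ofReal_natCast k, ← ofReal_natCast n,
    cpow_def_of_ne_zero (by exact_mod_cast hk'.ne'), cpow_def_of_ne_zero (by exact_mod_cast hn'.ne'), ← Complex.exp_add]
  congr 1
  rw [← ofReal_log hq.le, ← ofReal_log hk'.le, ← ofReal_log hn'.le, Real.log_div hn'.ne' (by positivity), Real.log_pow]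
  push_cast
  ring

/-- **(eq:FE) on the left line, expanded**: for `y ∈ ℝ` and `s = 13/12 − iy`,
`F(−1/12 + iy) = F(1 − s) = 3ε Σ_{n} β^ε_n · G^ε(s) (n/m⁴)^{−s} X^{4−s}` (the FE of the schema, `K(1−s)Δ(s)/Δ(1−s) = G(s)`,
and the dual Dirichlet series). [cite: BhargavaTaniguchiThorne2023, §3 proof of Thm 3.1 ("We then use the functional equation, expand the dual zeta function ξ(s, Φ̂_m) as an absolutely convergent Dirichlet series")] -/
theorem perronF_left_eq_tsum [NeZero m] (hU : btt_uniformity_sqDvd) {Φ : BinaryCubic (ZMod m) → ℂ}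
    (hFE : HasShintaniFE Φ) {ε : ℤ} (hε : ε = 1 ∨ ε = -1) (X : ℝ) (y : ℝ) :
    perronF ε Φ X (((-1 / 12 : ℝ) : ℂ) + y * I) = 3 * (ε : ℂ) *
      ∑' n : ℕ, dualThetaCoeff ε Φ n * kernelIntegrand ε ((n : ℝ) / (m : ℝ) ^ 4) X (((13 / 12 : ℝ) : ℂ) + (-y : ℝ) * I) := by
  set s : ℂ := ((13 / 12 : ℝ) : ℂ) + (-y : ℝ) * I with hs
  have hz : ((-1 / 12 : ℝ) : ℂ) + y * I = 1 - s := by simp only [hs]; push_cast; ring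
  have hsre : s.re = 13 / 12 := by simp [hs]
  have hs1 : s ≠ 1 := fun h => by have := congrArg re h; rw [hsre] at this; norm_num at this
  have hs2 : s ≠ 2 := fun h => by have := congrArg re h; rw [hsre] at this; norm_num at this
  have hs3 : s ≠ 3 := fun h => by have := congrArg re h; rw [hsre] at this; norm_num at this
  have hs4 : s ≠ 4 := fun h => by have := congrArg re h; rw [hsre] at this; norm_num at this
  have hs0 : -s ≠ 0 := fun h => by have := congrArg re h; rw [neg_re, hsre] at this; norm_num at this
  have hm := NeZero.pos m
  rw [hz, perronF, hFE.fe ε hε s (by rw [hsre]; norm_num) (by rw [hsre]; norm_num),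
    dualTheta_eq_LSeries hU ε Φ (by rw [hsre]; norm_num), LSeries, show (3 : ℂ) + (1 - s) = 4 - s by ring]
  have hK : delta ε s / delta ε (1 - s) * perronK (1 - s) = kernelG ε s := by
    rw [kernelG_eq ε hs1 hs2 hs3 hs4, perronK, div_mul_div_comm]
    congr 1 <;> ring
  calc (X : ℂ) ^ (4 - s) * (3 * (ε : ℂ) * (m : ℂ) ^ (4 * s) * (delta ε s / delta ε (1 - s)) *
        ∑' n, LSeries.term (dualThetaCoeff ε Φ) s n) * perronK (1 - s)
      = 3 * (ε : ℂ) * ((delta ε s / delta ε (1 - s) * perronK (1 - s)) * ((m : ℂ) ^ (4 * s) * (X : ℂ) ^ (4 - s)) *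
          ∑' n, LSeries.term (dualThetaCoeff ε Φ) s n) := by ring
    _ = 3 * (ε : ℂ) * ∑' n, kernelG ε s * ((m : ℂ) ^ (4 * s) * (X : ℂ) ^ (4 - s)) * LSeries.term (dualThetaCoeff ε Φ) s n := by
        rw [hK, ← tsum_mul_left]
    _ = _ := by
        congr 1
        refine tsum_congr fun n => ?_
        rcases Nat.eq_zero_or_pos n with rfl | hn
        · simp [LSeries.term, kernelIntegrand, zero_cpow hs0]
        · rw [LSeries.term_of_ne_zero hn.ne', kernelIntegrand, natDiv_cpow_neg hn hm s, div_eq_mul_inv, ← cpow_neg]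
          ring

/-- `∫ G^ε(13/12+iu) (ν)^{-w} X^{4-w} du = 2π T^ε_{13/12}(ν, X)`. [folklore] -/
theorem integral_kernelIntegrand_eq (ε : ℤ) (ν X : ℝ) :
    ∫ u : ℝ, kernelIntegrand ε ν X (((13 / 12 : ℝ) : ℂ) + u * I) = 2 * π * kernelT ε (13 / 12) ν X := by
  have hπ : (2 * π : ℂ) ≠ 0 := by exact_mod_cast (mul_pos two_pos Real.pi_pos).ne'
  rw [kernelT, ← mul_assoc, show (2 * π : ℂ) * (1 / (2 * π)) = 1 by field_simp, one_mul]

/-- **The left integral, termwise**: `∫ F(−1/12+iy) dy = 2π · 3ε Σ_n β^ε_n T^ε_{13/12}(n/m⁴, X)` (absolute convergence: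
`Σ_n |β_n| (n/m⁴)^{−13/12} ∫ |G(13/12+iu)| du < ∞`). [cite: BhargavaTaniguchiThorne2023, §3 proof of Thm 3.1 ("and switch the order of summation and integration")] -/
theorem integral_perronF_left [NeZero m] (hU : btt_uniformity_sqDvd) {Φ : BinaryCubic (ZMod m) → ℂ}
    (hFE : HasShintaniFE Φ) {ε : ℤ} (hε : ε = 1 ∨ ε = -1) {X : ℝ} (hX : 0 < X) :
    ∫ y : ℝ, perronF ε Φ X (((-1 / 12 : ℝ) : ℂ) + y * I) =
      2 * π * (3 * (ε : ℂ) * ∑' n : ℕ, dualThetaCoeff ε Φ n * kernelT ε (13 / 12) ((n : ℝ) / (m : ℝ) ^ 4) X) := by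
  have hm := NeZero.pos m
  have hm' : (0 : ℝ) < m := by exact_mod_cast hm
  set f : ℕ → ℝ → ℂ := fun n u =>
    dualThetaCoeff ε Φ n * kernelIntegrand ε ((n : ℝ) / (m : ℝ) ^ 4) X (((13 / 12 : ℝ) : ℂ) + u * I) with hf
  have hF : (fun y : ℝ => perronF ε Φ X (((-1 / 12 : ℝ) : ℂ) + y * I)) =
      fun y => (fun u : ℝ => 3 * (ε : ℂ) * ∑' n, f n u) (-y) := by
    funext y; rw [perronF_left_eq_tsum hU hFE hε X y]
  -- each term is integrable
  have hν : ∀ {n : ℕ}, 0 < n → (0 : ℝ) < (n : ℝ) / (m : ℝ) ^ 4 := fun hn => by positivity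
  have hf0 : f 0 = fun _ => 0 := by
    funext u
    simp only [hf, Nat.cast_zero, zero_div, kernelIntegrand, ofReal_zero]
    rw [zero_cpow (fun h => by have := congrArg re h; norm_num at this), zero_mul, mul_zero, mul_zero]
  have hint : ∀ n, Integrable (f n) := by
    intro n
    rcases Nat.eq_zero_or_pos n with rfl | hn
    · rw [hf0]; exact integrable_zero _ _ _
    · exact (integrable_kernelIntegrand (hν hn) hX hε (by norm_num) (by norm_num)).const_mul _
  -- Σ ∫ ‖f_n‖ < ∞
  set IG : ℝ := ∫ u : ℝ, ‖kernelG ε (((13 / 12 : ℝ) : ℂ) + u * I)‖ with hIG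
  have hnorm : ∀ n, ∫ u, ‖f n u‖ =
      ‖dualThetaCoeff ε Φ n‖ * (((n : ℝ) / (m : ℝ) ^ 4) ^ (-(13 / 12 : ℝ)) * X ^ (4 - 13 / 12 : ℝ)) * IG := by
    intro n
    rcases Nat.eq_zero_or_pos n with rfl | hn
    · rw [hf0]; simp [Real.zero_rpow (by norm_num : (-(13 / 12 : ℝ)) ≠ 0)]
    · rw [hIG, ← integral_const_mul]
      refine integral_congr_ae (ae_of_all _ fun u => ?_)
      simp only [hf, norm_mul, norm_kernelIntegrand (hν hn) hX]
      simp only [add_re, ofReal_re, mul_re, I_re, mul_zero, ofReal_im, I_im, mul_one, sub_self, add_zero]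
      ring
  have hsum : Summable fun n => ∫ u, ‖f n u‖ := by
    have hS := (summable_norm_dualThetaCoeff_mul hU hε Φ (σ := 13 / 12) (by norm_num)).mul_left
      (((m : ℝ) ^ 4) ^ (13 / 12 : ℝ) * X ^ (4 - 13 / 12 : ℝ) * IG)
    refine hS.congr fun n => ?_
    rw [hnorm n]
    rcases Nat.eq_zero_or_pos n with rfl | hn
    · simp [Real.zero_rpow (by norm_num : (-(13 / 12 : ℝ)) ≠ 0)]
    · have hn' : (0 : ℝ) < n := by exact_mod_cast hn
      rw [Real.div_rpow hn'.le (by positivity), Real.rpow_neg (by positivity : (0 : ℝ) ≤ (m : ℝ) ^ 4), div_inv_eq_mul]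
      ring
  have hswap := integral_tsum_of_summable_integral_norm hint hsum
  have hTn : ∀ n, ∫ u, f n u = dualThetaCoeff ε Φ n * (2 * π * kernelT ε (13 / 12) ((n : ℝ) / (m : ℝ) ^ 4) X) := by
    intro n
    simp only [hf]
    rw [integral_const_mul, integral_kernelIntegrand_eq]
  rw [hF, integral_neg_eq_self (fun u : ℝ => 3 * (ε : ℂ) * ∑' n, f n u) volume, integral_const_mul, ← hswap]
  simp_rw [hTn]
  rw [← tsum_mul_left, ← tsum_mul_left, ← tsum_mul_left]
  exact tsum_congr fun n => by ring

/-- **Landau's contour identity (BTT (eqn:perron) shifted, k = 3, diagonal form).** For `X > 0`, under the schema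
`HasShintaniFE Φ` and Prop. 4.5 (`q = 1`):
`Σ_{n ≤ X} f^ε_n (X − n)³ = X⁴ρ^ε_1/4 + X^{23/6} ρ^ε_{5/6} K(5/6) + X³ θ^ε_cont(0) + 3ε Σ_n β^ε_n T^ε_{13/12}(n/m⁴, X)`.
[cite: BhargavaTaniguchiThorne2023, §3 proof of Thm 3.1 (the display after (eqn:perron): Σ_{σ∈{1,5/6}} X^{k+σ}/(σ(σ+1)⋯(σ+k)) Res ξ + (X^k/k!) ξ(0) + m^{4k+4} Σ a(Φ̂_m,n) n^{-k-1} I_k(nX/m⁴))] -/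
theorem rieszTheta_eq [NeZero m] (hU : btt_uniformity_sqDvd) {Φ : BinaryCubic (ZMod m) → ℂ} (hFE : HasShintaniFE Φ)
    {ε : ℤ} (hε : ε = 1 ∨ ε = -1) {X : ℝ} (hX : 0 < X) :
    rieszTheta ε Φ X = (X : ℂ) ^ (4 : ℂ) * (rhoOne ε Φ / 4) + (X : ℂ) ^ ((23 : ℂ) / 6) * (rhoFiveSixths ε Φ * perronK (5 / 6))
      + (X : ℂ) ^ (3 : ℂ) * thetaCont ε Φ 0
      + 3 * (ε : ℂ) * ∑' n : ℕ, dualThetaCoeff ε Φ n * kernelT ε (13 / 12) ((n : ℝ) / (m : ℝ) ^ 4) X := by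
  rw [rieszTheta_eq_integral hU hFE ε hX]
  have h := integral_perronF_two_sub_left hU hFE hε hX
  rw [integral_perronF_left hU hFE hε hX, sub_eq_iff_eq_add] at h
  have hπ : (π : ℂ) ≠ 0 := by exact_mod_cast Real.pi_pos.ne'
  rw [h]
  field_simp

end LandauContour

end Literature.NumberTheory.CubicFields

end
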